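import Literature.NumberTheory.Transcendental.Analytification     -- ★ `AlgPoints.continuous_evalOrZero_top`, `AlgPoints.eval_top`
import HarnessLib

/-!
# A regular function with `u^M = 1` is LOCALLY CONSTANT on the complex points ([SGA1] Exp. I Cor. 5.4: sections of an étale scheme
# (`μ_M`) are rigid; [MumfordAV1970] §20: the `e_n`-pairing is a section of `μ_n` over the base)

Layer `Literature/AlgebraicGeometry/Motives`, namespace `Literature.AlgebraicGeometry.Motives.AlgPoints`.  THEOREMS ONLY (no definition, no named fact,
no instance, no notation, no `sorry`).  Cell `hodgecm-mathlib` (D-0151), FLOOR 0, P6 «MOD» (crux hLiu418 = stmt-HodgeConjecture-24832, `--supports`),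
half A line L7, socket `stub_UNIVFAM` (★ P-3), organ O3 `stub_FLAT`, sub-organ FLAT-b(ii) «PAIRING READINGS CONSTANT ALONG A CHART», piece **W3**
(LA7-plan RULING 2026-09-02T02:22Z (3)–(4), route (α)).  HC_CM is proved only modulo the printed citations until rung 0 closes; count-neutral.

THE MATHEMATICS.  A global regular function `u ∈ Γ(X, 𝒪_X)` on a `k`-scheme `X` (`k ⊆ ℂ`) with `u^M = 1`, `M ≠ 0`, takes values in the `M`-th
roots of unity at every complex point; the value `P ↦ u(P) ∈ ℂ` is continuous for the analytic topology on `X(ℂ)` (★ `AlgPoints.continuous_evalOrZero_top`,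
★ `AlgPoints.eval_top`: `u(P) = ΓSpecIso (P^♯ u)`), and a continuous function with values in a finite subset of a Hausdorff space is locally
constant.  Composed with a continuous map `τ : W → X(ℂ)` from any space this gives local constancy along `τ` — the step of FLAT-b(ii) reading the
global pairing unit of ★ `TorsionSectionPairingUnitsFibrewise` along a local section of a finite étale cover ([MumfordAV1970] §20: `e_n` is a
section of the finite étale `μ_n`, hence locally constant; [SGA1] Exp. I Cor. 5.4).

* `eventually_appTop_eq_of_pow_eq_one` — the value `ΓSpecIso (P^♯ u)` of `u` with `u^M = 1` is locally constant on `X(ℂ)`;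
* `eventually_appTop_comp_eq_of_pow_eq_one` — the same along a map `τ` continuous at a point.

## References
* [MumfordAV1970] D. Mumford, *Abelian Varieties* (1970), §20 (pp. 183–185).
* [SGA1] A. Grothendieck, *Revêtements étales et groupe fondamental*, Exp. I Cor. 5.4 (rigidity of sections of étale schemes).
-/

set_option autoImplicit false

noncomputable section

universe u

open CategoryTheory AlgebraicGeometry Topology Filter Set

namespace Literature.AlgebraicGeometry.Motives.AlgPoints

/-- **A continuous function into a T₁ space with finite range is locally constant.** [folklore] -/
private theorem eventually_eq_of_continuous_of_finite_range {Y Z : Type*} [TopologicalSpace Y] [TopologicalSpace Z] [T1Space Z]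
    {F : Y → Z} (hF : Continuous F) {R : Set Z} (hR : R.Finite) (hFR : ∀ y, F y ∈ R) (y₀ : Y) : ∀ᶠ y in 𝓝 y₀, F y = F y₀ := by
  -- the other values form a finite, hence closed, set; its complement is an open neighbourhood of `F y₀`
  have hclosed : IsClosed (R \ {F y₀}) := (hR.subset fun z hz => hz.1).isClosed
  have hopen : IsOpen ((R \ {F y₀})ᶜ) := hclosed.isOpen_compl
  have hmem : F y₀ ∈ (R \ {F y₀})ᶜ := fun h => h.2 rfl
  filter_upwards [hF.continuousAt.preimage_mem_nhds (hopen.mem_nhds hmem)] with y hy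
  by_contra hne
  exact hy ⟨hFR y, hne⟩

variable {k : Type} [Field k] [Algebra k ℂ] {X : SchemeOver k}

/-- The value `ΓSpecIso (P^♯ u)` of a global function at a complex point is its `evalOrZero` on `⊤` (★ `eval_top`). [folklore] -/
private theorem ΓSpecIso_appTop_eq_evalOrZero (u : Γ(X.left, ⊤)) (P : ComplexPoints X) :
    (Scheme.ΓSpecIso (.of ℂ)).hom (P.left.appTop u) = evalOrZero ⊤ u P := by
  rw [evalOrZero_of_mem u (show P.pt ∈ (⊤ : X.left.Opens) from trivial), eval_top]
  rfl

/-- **A REGULAR FUNCTION WITH `u^M = 1` (`M ≠ 0`) IS LOCALLY CONSTANT ON THE COMPLEX POINTS**: its value `ΓSpecIso (P^♯ u) ∈ ℂ` is continuous in `P`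
(analytic topology) and is an `M`-th root of unity. [cite: MumfordAV1970, §20 (pp. 183–185)] [cite: SGA1, Exp. I Cor. 5.4] -/
theorem eventually_appTop_eq_of_pow_eq_one (u : Γ(X.left, ⊤)) {M : ℕ} (hM : M ≠ 0) (hu : u ^ M = 1) (P₀ : ComplexPoints X) :
    ∀ᶠ P in 𝓝 P₀, (Scheme.ΓSpecIso (.of ℂ)).hom (P.left.appTop u) = (Scheme.ΓSpecIso (.of ℂ)).hom (P₀.left.appTop u) := by
  have hF : Continuous fun P : ComplexPoints X => (Scheme.ΓSpecIso (.of ℂ)).hom (P.left.appTop u) := by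
    have h := continuous_evalOrZero_top (X := X) (L := ℂ) u
    refine h.congr fun P => ?_
    exact (ΓSpecIso_appTop_eq_evalOrZero u P).symm
  -- values are `M`-th roots of unity, a finite set
  have hroots : ∀ P : ComplexPoints X, ((Scheme.ΓSpecIso (.of ℂ)).hom (P.left.appTop u)) ^ M = 1 := fun P => by
    let ev : Γ(X.left, ⊤) →+* ℂ := (Scheme.ΓSpecIso (.of ℂ)).hom.hom.comp P.left.appTop.hom
    have hev : ∀ x, ev x = (Scheme.ΓSpecIso (.of ℂ)).hom (P.left.appTop x) := fun _ => rfl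
    rw [← hev, ← map_pow, hu, map_one]
  have hR : ((Polynomial.nthRootsFinset M (1 : ℂ)) : Set ℂ).Finite := Finset.finite_toSet _
  refine eventually_eq_of_continuous_of_finite_range hF hR (fun P => ?_) P₀
  rw [Finset.mem_coe, Polynomial.mem_nthRootsFinset (Nat.pos_of_ne_zero hM)]
  exact hroots P

/-- **… and along any map continuous at a point**: for `τ : W → X(ℂ)` continuous at `w₀`, the value of `u` at `τ w` equals its value at `τ w₀`
for `w` near `w₀`. [cite: MumfordAV1970, §20 (pp. 183–185)] [cite: SGA1, Exp. I Cor. 5.4] -/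
theorem eventually_appTop_comp_eq_of_pow_eq_one (u : Γ(X.left, ⊤)) {M : ℕ} (hM : M ≠ 0) (hu : u ^ M = 1)
    {W : Type*} [TopologicalSpace W] {τ : W → ComplexPoints X} {w₀ : W} (hτ : ContinuousAt τ w₀) :
    ∀ᶠ w in 𝓝 w₀, (Scheme.ΓSpecIso (.of ℂ)).hom ((τ w).left.appTop u) = (Scheme.ΓSpecIso (.of ℂ)).hom ((τ w₀).left.appTop u) :=
  hτ.eventually (eventually_appTop_eq_of_pow_eq_one u hM hu (τ w₀))

/-- The `ContinuousWithinAt` form (local sections of coverings are given on opens of the base). [cite: SGA1, Exp. I Cor. 5.4] -/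
theorem eventually_nhdsWithin_appTop_comp_eq_of_pow_eq_one (u : Γ(X.left, ⊤)) {M : ℕ} (hM : M ≠ 0) (hu : u ^ M = 1)
    {W : Type*} [TopologicalSpace W] {τ : W → ComplexPoints X} {s : Set W} {w₀ : W} (hτ : ContinuousWithinAt τ s w₀) :
    ∀ᶠ w in 𝓝[s] w₀, (Scheme.ΓSpecIso (.of ℂ)).hom ((τ w).left.appTop u) = (Scheme.ΓSpecIso (.of ℂ)).hom ((τ w₀).left.appTop u) :=
  hτ.eventually (eventually_appTop_eq_of_pow_eq_one u hM hu (τ w₀))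

end Literature.AlgebraicGeometry.Motives.AlgPoints

end
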